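import Mathlib.NumberTheory.Zsqrtd.Basic
import Mathlib.LinearAlgebra.Matrix.Notation
import Mathlib.LinearAlgebra.Matrix.Determinant.Basic
import Mathlib.Tactic.Ring
import Mathlib.Tactic.LinearCombination
import Mathlib.Tactic.NormNum
import HarnessLib

/-!
# Venture HSemireg — the continued-fraction TRANSPORT FORMULA of a factorwise `SL₂(ℤ)` word (ENGINE-W code B,
# THEOREM CF ∕ THEOREM CF⁶ and the «reachable LINES» divisibility clause) — kernel algebra

HONEST FRAMING. Lean index of the computation cell `pub-hsemireg`, widening group ENGINE-W (code B = the independent second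
code, seat `engine-w-2`, gen 10). RING IDENTITIES in a commutative ring containing an element `l` with `l² = m`, `2 × 2` integer
matrix words, and DIVISIBILITY in Mathlib's `ℤ√m`; the secant engine, the node-pair seed `e^{lh} + e^{−lh} + w`, the words
`twist ∕ FF{j}` and «class-exact on a coordinate Weil datum» enter BY VALUE (docstrings). No abelian variety, sheaf, `Ext` group or
semiregularity map is constructed; nothing here says that HC, HC_CM or HC_AV holds. Theorems only (0 `def`, 0 named fact,
0 `sorry`).

SOURCE (the cell's own result, code B): `widen/ENGINE-W/out/probe4/ONE-FOURIER-FORMULA-B.md` §7 (THEOREM CF, v1.3) and §8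
(THEOREM CF⁶ + COROLLARY «reachable LINES», v1.4); machine legs `codeB/cf_B.py` → `out/probe4/cf.B.json` (252 random words + 450
controls), `codeB/twof_check.py`, `codeB/r1line_check.py`, and today's `codeB/q162_B.py` → `out/probe4/q162-line-m5.B.json`
(TABLE-ENGINE-W row 504: the `ℚ(√−5)` seed reaches the line `(2,2,2 ∣ 3,3,3)`). SETTING (by value, as printed): node field
`k′ = ℚ(l)`, `l² = m`; a word on factor `j` is `γ_j = T_{n_r}·S·…·S·T_{n₀} ∈ SL₂(ℤ)` (`T_n = [[1,0],[n,1]]` = the diagonal twist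
`n` on that factor, `S = [[0,1],[−1,0]]` = the principal Fourier `FF{j}`), `γ = [[α,β],[γ′,δ]]`; it sends the slope-`c`
exponential to `(α + βc)·e^{μ(c)p}`, `μ(c) = (γ′ + δc)∕(α + βc)`. THEOREM CF (§7, one free factor, twist `a` on the others):
«class-exact on a coordinate Weil datum **iff `a = αγ′ − βδ·m` and `N_γ := α² − β²m > 0`**; then `h′ ∝ (N_γ,…,N_γ,1)`, nodes
`(a ± l)∕N_γ`» — PROOF as printed: class-exact ⟺ `μ(l)∕(a+l) = μ(−l)∕(a−l)` ⟺ `(a+l)(α+βl)(γ′−δl) = (a−l)(α−βl)(γ′+δl)`, whose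
`l`-part is `(aβ+α)γ′ − (aα+βm)δ`, `= 0` ⟺ `a = αγ′ − βδm` (det `γ = 1`); «then `(a+l)(α+βl) = N_γ(γ′+δl)`». THEOREM CF⁶ (§8,
a word on every factor): `μ_j(l) = (A_j + l)∕N_j` with `A_j := α_jγ′_j − β_jδ_jm`, `N_j := α_j² − β_j²m = N(z_j)`,
`z_j := α_j + β_jl`; class-exact ⟺ all `A_j` equal; «for fixed first rows `(α_j,β_j)` the completions `(γ′_j,δ_j)` sweep `A_j`
over the residue class `A_j⁰ + N_jℤ`, and **`A ≡ A_j⁰ (mod N_j) ⟺ z_j ∣ (A − l)` in the ORDER `ℤ[l]`**». What the kernel holds: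

* §1 (any commutative ring, `l·l = m`): `moebius_numerator` — `(γ′ + δl)(α − βl) = (αγ′ − βδm) + (αδ − βγ′)·l` (so `μ(l) =
  (A + l)∕N` when det `= 1`); **`transport_identity`** — `(A + l)(α + βl) = (α² − β²m)(γ′ + δl)`; **`classExact_lpart`** — the
  printed `l`-part computation `(a+l)(α+βl)(γ′−δl) − (a−l)(α−βl)(γ′+δl) = 2l·((aβ+α)γ′ − (aα+βm)δ)` and, with det `= 1`,
  `= 2l·((αγ′ − βδm) − a)` (`classExact_lpart_det`); hence in a domain with `2l ≠ 0` the printed «iff» (`classExact_iff`);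
  `cofactor_identity` — `(α + βl)(γ′ − δl) = (αγ′ − βδm) − l`: the explicit cofactor exhibiting `z ∣ (A − l)`.
* §2 (completions): `completion_det` ∕ `completion_A` — `(γ′ + kα, δ + kβ)` completes the same first row and shifts `A` by
  `k·(α² − β²m)`; `completion_exhaust` — conversely two completions of one first row differ by such a `k`, with the explicit
  `k = δ(γ″ − γ′) − γ′(δ′ − δ)` (pure ring consequence of the two determinant equations): the sweep is EXACTLY `A⁰ + Nℤ`.
* §3 (Mathlib `ℤ√m`): `dvd_A_sub_l` — `⟨α, β⟩ ∣ ⟨αγ′ − βδm, −1⟩` (= `z ∣ A⁰ − l`); `norm_dvd_of_dvd_intCast` — a PRIMITIVE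
  `z` (`uα + vβ = 1`) dividing a rational integer `n` in `ℤ√m` has `N(z) ∣ n`; **`residue_class_iff`** — for `αδ − βγ′ = 1`:
  `⟨α, β⟩ ∣ ⟨A, −1⟩ ↔ (α² − β²m) ∣ A − (αγ′ − βδm)` — the divisibility clause of THEOREM CF⁶ ∕ COROLLARY «reachable LINES», in full.
* §4 (words): `T_mul_S_mul_T` — `T_k·S·T_b = [[b, 1],[kb − 1, k]]` (the one-Fourier word; LEMMA 1F: `a = k(b² − m) − b`,
  `N = b² − m`: `oneFourier_parameters`); `det_T`, `det_S`.
* §5 (instances of record, `decide` ∕ `norm_num`): the Q-16-2 words at `m = −5` (`[[2,1],[1,1]]`: `A = 7`, `N = 9`;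
  `[[−1,1],[−2,1]]`: `A = 7`, `N = 6`; `7 − l = (2 + l)(1 − l) = (−1 + l)(−2 − l)` in `ℤ√−5`), the R1-proper words at `ℚ(i)`
  (`z = 1 + i`, `A = 2k − 1`) and `ℚ(√−2)` (`z = √−2`, `A = 2k`), and the silver word (`z = 2 + √2`, `A = 2k − 2`).
WHAT IS NOT HERE: the secant-engine facts (that a word acts through `γ` on the coefficient plane, LEMMA 1F's «⇒», W-aliveness,
`h′` and the node formula), positivity `N_γ > 0` ⟺ polarisation, THEOREM STI, the 2-adic obstruction for `ℚ(√−7)` at R1 proper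
(§8, hand ×1 + machine ×1 (B)). Tier of the source: hand ×1 (B) + machine ×1 (B) (cf.B.json 211∕211 + 450 controls; the four
`requests/cf-witness/` and three `requests/r1line-witness/` files await code A's CLI for ×2).
-/

namespace Summit.Ventures.HSemireg.TransportCF

/-! ## §1 The transport identities in a commutative ring with `l·l = m` -/

/-- `(γ′ + δl)(α − βl) = (αγ′ − βδm) + (αδ − βγ′)·l`: the numerator of `μ(l) = (γ′ + δl)∕(α + βl)` after multiplying through by
the conjugate `α − βl`; with det `γ = 1` the `l`-coefficient is `1`, i.e. `μ(l) = (A + l)∕N`. [kernel] -/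
theorem moebius_numerator {R : Type*} [CommRing R] (l m α β γ' δ : R) (hl : l * l = m) :
    (γ' + δ * l) * (α - β * l) = (α * γ' - β * δ * m) + (α * δ - β * γ') * l := by
  linear_combination (-(β * δ)) * hl

/-- **THEOREM CF's transport identity** «`(a + l)(α + βl) = N_γ(γ′ + δl)`» with `a = αγ′ − βδm`, `N_γ = α² − β²m`, for
`αδ − βγ′ = 1`. [kernel] -/
theorem transport_identity {R : Type*} [CommRing R] (l m α β γ' δ : R) (hl : l * l = m) (hdet : α * δ - β * γ' = 1) :
    (α * γ' - β * δ * m + l) * (α + β * l) = (α ^ 2 - β ^ 2 * m) * (γ' + δ * l) := by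
  linear_combination (-(l * α) - β * m) * hdet + β * hl

/-- **The printed `l`-part computation** (no determinant hypothesis): `(a+l)(α+βl)(γ′−δl) − (a−l)(α−βl)(γ′+δl)
= 2l·((aβ + α)γ′ − (aα + βm)δ)`. [kernel] -/
theorem classExact_lpart {R : Type*} [CommRing R] (l m a α β γ' δ : R) (hl : l * l = m) :
    (a + l) * (α + β * l) * (γ' - δ * l) - (a - l) * (α - β * l) * (γ' + δ * l)
      = 2 * l * ((a * β + α) * γ' - (a * α + β * m) * δ) := by
  linear_combination (-(2 * l * β * δ)) * hl

/-- With `αδ − βγ′ = 1` the `l`-part is `2l·((αγ′ − βδm) − a)`: it vanishes exactly at THEOREM CF's `a`. [kernel] -/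
theorem classExact_lpart_det {R : Type*} [CommRing R] (l m a α β γ' δ : R) (hl : l * l = m) (hdet : α * δ - β * γ' = 1) :
    (a + l) * (α + β * l) * (γ' - δ * l) - (a - l) * (α - β * l) * (γ' + δ * l)
      = 2 * l * ((α * γ' - β * δ * m) - a) := by
  rw [classExact_lpart l m a α β γ' δ hl]
  linear_combination (-(2 * l * a)) * hdet

/-- **THEOREM CF's «iff» at the level of the printed equation**: in a domain where `2l ≠ 0`, for `αδ − βγ′ = 1`,
`(a+l)(α+βl)(γ′−δl) = (a−l)(α−βl)(γ′+δl) ↔ a = αγ′ − βδm`. (That this equation IS class-exactness of the image on a coordinate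
Weil datum is the engine fact of §6 of the source, by value.) [kernel] -/
theorem classExact_iff {R : Type*} [CommRing R] [IsDomain R] (l m a α β γ' δ : R) (hl : l * l = m)
    (hdet : α * δ - β * γ' = 1) (h2l : (2 : R) * l ≠ 0) :
    (a + l) * (α + β * l) * (γ' - δ * l) = (a - l) * (α - β * l) * (γ' + δ * l) ↔ a = α * γ' - β * δ * m := by
  constructor
  · intro h
    have h0 : 2 * l * ((α * γ' - β * δ * m) - a) = 0 := by
      rw [← classExact_lpart_det l m a α β γ' δ hl hdet]; exact sub_eq_zero.mpr h
    rcases mul_eq_zero.mp h0 with h1 | h1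
    · exact absurd h1 h2l
    · exact (sub_eq_zero.mp h1).symm
  · intro ha
    apply sub_eq_zero.mp
    rw [classExact_lpart_det l m a α β γ' δ hl hdet, ha, sub_self, mul_zero]

/-- **The cofactor**: `(α + βl)(γ′ − δl) = (αγ′ − βδm) − l` for `αδ − βγ′ = 1` — so `z = α + βl` divides `A⁰ − l` with the explicit
cofactor `γ′ − δl` (and `z̄ = α − βl` divides `A⁰ + l`, `moebius_numerator`). [kernel] -/
theorem cofactor_identity {R : Type*} [CommRing R] (l m α β γ' δ : R) (hl : l * l = m) (hdet : α * δ - β * γ' = 1) :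
    (α + β * l) * (γ' - δ * l) = (α * γ' - β * δ * m) - l := by
  linear_combination (-(β * δ)) * hl - l * hdet

/-! ## §2 Completions of a first row sweep `A` over exactly one residue class modulo `N` -/

/-- `(γ′ + kα, δ + kβ)` is again a completion of the first row `(α, β)` to determinant `1`. [kernel] -/
theorem completion_det {R : Type*} [CommRing R] (α β γ' δ k : R) (hdet : α * δ - β * γ' = 1) :
    α * (δ + k * β) - β * (γ' + k * α) = 1 := by
  linear_combination hdet

/-- … and it shifts `A = αγ′ − βδm` by `k·(α² − β²m) = k·N`. [kernel, `ring`] -/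
theorem completion_A {R : Type*} [CommRing R] (m α β γ' δ k : R) :
    α * (γ' + k * α) - β * (δ + k * β) * m = (α * γ' - β * δ * m) + k * (α ^ 2 - β ^ 2 * m) := by
  ring

/-- **Exhaustion**: two completions `(γ′, δ)`, `(γ″, δ′)` of the same first row (both determinants `1`) differ by the multiple
`k = δ(γ″ − γ′) − γ′(δ′ − δ)` of `(α, β)` — a ring consequence of the two determinant equations (no gcd argument needed). Hence
the completions sweep `A` over EXACTLY `A⁰ + N·ℤ`. [kernel] -/
theorem completion_exhaust {R : Type*} [CommRing R] (α β γ' δ γ'' δ' : R) (hdet : α * δ - β * γ' = 1)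
    (hdet' : α * δ' - β * γ'' = 1) :
    γ'' = γ' + (δ * (γ'' - γ') - γ' * (δ' - δ)) * α ∧ δ' = δ + (δ * (γ'' - γ') - γ' * (δ' - δ)) * β := by
  constructor
  · linear_combination (-γ'') * hdet + γ' * hdet'
  · linear_combination (-δ') * hdet + δ * hdet'

/-! ## §3 The divisibility clause in `ℤ√m` (Mathlib `Zsqrtd`): `A ≡ A⁰ (mod N) ↔ z ∣ (A − l)` -/

/-- `z = ⟨α, β⟩ = α + βl` divides `A⁰ − l = ⟨αγ′ − βδm, −1⟩` in `ℤ√m` when `αδ − βγ′ = 1`, with cofactor `⟨γ′, −δ⟩`. [kernel] -/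
theorem dvd_A_sub_l (m α β γ' δ : ℤ) (hdet : α * δ - β * γ' = 1) :
    (⟨α, β⟩ : ℤ√m) ∣ ⟨α * γ' - β * δ * m, -1⟩ := by
  refine ⟨⟨γ', -δ⟩, ?_⟩
  rw [Zsqrtd.ext_iff]
  simp only [Zsqrtd.re_mul, Zsqrtd.im_mul]
  constructor
  · ring
  · linear_combination hdet

/-- **A primitive element dividing a rational integer has norm dividing it**: if `u·α + v·β = 1` and `z = ⟨α, β⟩ ∣ n` in `ℤ√m`
then `N(z) = α² − mβ² ∣ n` (because `n·z̄ = N(z)·w̄`… componentwise `N(z) ∣ nα`, `N(z) ∣ nβ`). By value this is «`z ∣ n` in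
`ℤ[l]` ⟺ `N ∣ nα ∧ N ∣ nβ`» of the source. [kernel] -/
theorem norm_dvd_of_dvd_intCast (m u v n : ℤ) (z : ℤ√m) (hbez : u * z.re + v * z.im = 1) (h : z ∣ (n : ℤ√m)) :
    z.norm ∣ n := by
  obtain ⟨w, hw⟩ := h
  -- components of `n = z * w`: `n = z.re * w.re + m * z.im * w.im`, `0 = z.re * w.im + z.im * w.re`
  have hre : n = z.re * w.re + m * z.im * w.im := by
    have := congrArg Zsqrtd.re hw
    simpa only [Zsqrtd.re_intCast, Zsqrtd.re_mul] using this
  have him : (0 : ℤ) = z.re * w.im + z.im * w.re := by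
    have := congrArg Zsqrtd.im hw
    simpa only [Zsqrtd.im_intCast, Zsqrtd.im_mul] using this
  -- hence `n * z.re = N(z) * w.re` and `n * z.im = -N(z) * w.im`
  have h1 : z.norm ∣ n * z.re := by
    refine ⟨w.re, ?_⟩
    rw [Zsqrtd.norm_def]
    linear_combination z.re * hre - m * z.im * him
  have h2 : z.norm ∣ n * z.im := by
    refine ⟨-w.im, ?_⟩
    rw [Zsqrtd.norm_def]
    linear_combination z.im * hre - z.re * him
  have : n = u * (n * z.re) + v * (n * z.im) := by linear_combination (-n) * hbez
  rw [this]
  exact dvd_add (dvd_mul_of_dvd_right h1 u) (dvd_mul_of_dvd_right h2 v)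

/-- **THEOREM CF⁶'s divisibility clause ∕ COROLLARY «reachable LINES», in full.** For a first row `(α, β)` completed by
`(γ′, δ)` with `αδ − βγ′ = 1` (so `A⁰ = αγ′ − βδm`, `N = α² − β²m`, and `(α, β)` is automatically primitive: `δα − γ′β = 1`):
`z = α + βl` divides `A − l` in `ℤ√m` **iff** `N ∣ A − A⁰`. [kernel] -/
theorem residue_class_iff (m α β γ' δ A : ℤ) (hdet : α * δ - β * γ' = 1) :
    (⟨α, β⟩ : ℤ√m) ∣ ⟨A, -1⟩ ↔ (α ^ 2 - β ^ 2 * m) ∣ A - (α * γ' - β * δ * m) := by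
  have hz0 : (⟨α, β⟩ : ℤ√m) ∣ ⟨α * γ' - β * δ * m, -1⟩ := dvd_A_sub_l m α β γ' δ hdet
  have hnorm : (⟨α, β⟩ : ℤ√m).norm = α ^ 2 - β ^ 2 * m := by rw [Zsqrtd.norm_def]; ring
  constructor
  · intro h
    have hdiff : (⟨α, β⟩ : ℤ√m) ∣ ((A - (α * γ' - β * δ * m) : ℤ) : ℤ√m) := by
      have e : ((A - (α * γ' - β * δ * m) : ℤ) : ℤ√m) = ⟨A, -1⟩ - ⟨α * γ' - β * δ * m, -1⟩ := by
        rw [Zsqrtd.intCast_val]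
        ext <;> simp
      rw [e]; exact dvd_sub h hz0
    have hbez : δ * (⟨α, β⟩ : ℤ√m).re + (-γ') * (⟨α, β⟩ : ℤ√m).im = 1 := by
      show δ * α + (-γ') * β = 1
      linear_combination hdet
    have := norm_dvd_of_dvd_intCast m δ (-γ') _ ⟨α, β⟩ hbez hdiff
    rwa [hnorm] at this
  · rintro ⟨k, hk⟩
    have e : (⟨A, -1⟩ : ℤ√m) = ⟨α * γ' - β * δ * m, -1⟩ + ⟨(α ^ 2 - β ^ 2 * m) * k, 0⟩ := by
      rw [Zsqrtd.ext_iff]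
      simp only [Zsqrtd.re_add, Zsqrtd.im_add]
      constructor
      · linear_combination hk
      · ring
    have hN : (⟨(α ^ 2 - β ^ 2 * m) * k, 0⟩ : ℤ√m) = ⟨α, β⟩ * (star ⟨α, β⟩ * ⟨k, 0⟩) := by
      rw [Zsqrtd.star_mk, Zsqrtd.ext_iff]
      simp only [Zsqrtd.re_mul, Zsqrtd.im_mul]
      constructor <;> ring
    rw [e]
    exact dvd_add hz0 ⟨_, hN⟩

/-! ## §4 The words: `T_n`, `S` and the one-Fourier word `T_k·S·T_b` -/

/-- `T_k·S·T_b = [[b, 1],[kb − 1, k]]` for `T_n = [[1,0],[n,1]]`, `S = [[0,1],[−1,0]]` (the word `twist b · FF · twist k` on one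
factor; any commutative ring). [kernel] -/
theorem T_mul_S_mul_T {R : Type*} [CommRing R] (k b : R) :
    !![(1 : R), 0; k, 1] * !![(0 : R), 1; -1, 0] * !![(1 : R), 0; b, 1] = !![b, 1; k * b - 1, k] := by
  ext i j
  fin_cases i <;> fin_cases j <;> (simp [Matrix.mul_apply, Fin.sum_univ_two]; try ring)

/-- `det T_n = 1`, `det S = 1` (so every word lies in `SL₂`). [kernel] -/
theorem det_T_S {R : Type*} [CommRing R] (n : R) :
    Matrix.det !![(1 : R), 0; n, 1] = 1 ∧ Matrix.det !![(0 : R), 1; -1, 0] = 1 := by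
  constructor <;> simp [Matrix.det_fin_two]

/-- **LEMMA 1F's parameters from THEOREM CF**: for `γ = [[b, 1],[kb − 1, k]]` (`α = b`, `β = 1`, `γ′ = kb − 1`, `δ = k`):
`a = αγ′ − βδm = k(b² − m) − b` and `N = α² − β²m = b² − m`; determinant `1`. [kernel, `ring`] -/
theorem oneFourier_parameters {R : Type*} [CommRing R] (m k b : R) :
    b * (k * b - 1) - 1 * k * m = k * (b ^ 2 - m) - b ∧ b ^ 2 - 1 ^ 2 * m = b ^ 2 - m ∧ b * k - 1 * (k * b - 1) = 1 := by
  refine ⟨by ring, by ring, by ring⟩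

/-! ## §5 Instances of record -/

/-- **Q-16-2 (TABLE-ENGINE-W row 504), `m = −5`**: the weight-2 word `γ = T₁·S·T₂ = [[2,1],[1,1]]` has `A = 2·1 − 1·1·(−5) = 7`,
`N = 4 + 5 = 9`, det `1`; the weight-3 word `γ = T₁·S·T₋₁ = [[−1,1],[−2,1]]` has `A = (−1)(−2) − 1·1·(−5) = 7`, `N = 1 + 5 = 6`,
det `1`; common `A = 7`, `T = 9·2 = 6·3 = 18`. [kernel, `norm_num`] -/
theorem q162_words :
    (2 : ℤ) * 1 - 1 * 1 * (-5) = 7 ∧ (2 : ℤ) ^ 2 - 1 ^ 2 * (-5) = 9 ∧ (2 : ℤ) * 1 - 1 * 1 = 1 ∧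
      (-1 : ℤ) * (-2) - 1 * 1 * (-5) = 7 ∧ (-1 : ℤ) ^ 2 - 1 ^ 2 * (-5) = 6 ∧ (-1 : ℤ) * 1 - 1 * (-2) = 1 ∧
      (9 : ℤ) * 2 = 18 ∧ (6 : ℤ) * 3 = 18 := by
  norm_num

/-- … and the divisibilities `z ∣ (7 − l)` in `ℤ√−5` with their cofactors: `7 − √−5 = (2 + √−5)(1 − √−5) = (−1 + √−5)(−2 − √−5)`.
[kernel, `decide`] -/
theorem q162_divisibility :
    (⟨7, -1⟩ : ℤ√(-5)) = ⟨2, 1⟩ * ⟨1, -1⟩ ∧ (⟨7, -1⟩ : ℤ√(-5)) = ⟨-1, 1⟩ * ⟨-2, -1⟩ := by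
  constructor <;> ext <;> simp

/-- **R1 PROPER words (§8 of the source)**: `ℚ(i)` (`m = −1`): `γ = T_k·S·T₁ = [[1,1],[k−1,k]]`, `z = 1 + i`, `N = 2`,
`A = (k − 1) + k = 2k − 1`; `ℚ(√−2)`: `γ = T_k·S·T₀ = [[0,1],[−1,k]]`, `z = √−2`, `N = 2`, `A = 2k`; silver `ℚ(√2)`:
`γ = T_k·S·T₂ = [[2,1],[2k−1,k]]`, `z = 2 + √2`, `N = 2`, `A = 2(2k−1) − 2k = 2k − 2`. [kernel, `ring`] -/
theorem r1proper_words (k : ℤ) :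
    (1 * (k * 1 - 1) - 1 * k * (-1) = 2 * k - 1 ∧ (1 : ℤ) ^ 2 - 1 ^ 2 * (-1) = 2) ∧
      (0 * (k * 0 - 1) - 1 * k * (-2) = 2 * k ∧ (0 : ℤ) ^ 2 - 1 ^ 2 * (-2) = 2) ∧
      (2 * (k * 2 - 1) - 1 * k * 2 = 2 * k - 2 ∧ (2 : ℤ) ^ 2 - 1 ^ 2 * 2 = 2) := by
  refine ⟨⟨by ring, by norm_num⟩, ⟨by ring, by norm_num⟩, ⟨by ring, by norm_num⟩⟩

end Summit.Ventures.HSemireg.TransportCF
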